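import Literature.Probability.RandomPlanarGeometry.LoewnerPartialContact
import Literature.Probability.RandomPlanarGeometry.SLEImageLocalisation
import HarnessLib

/-!
# The through-swallow horizon of the locality martingale of SLE_κ under a `*`-hull: definitions

Topic `Probability/RandomPlanarGeometry`; definitions + unfolding lemmas. In the proof of the
locality of chordal SLE₆ with respect to a nonempty `*`-hull `A` (Lawler–Schramm–Werner (2001)
Thm. 2.2; G. F. Lawler (2005) §6.3 Thm. 6.13) in its neighbourhood form (the stopping set contains
the `δ`-neighbourhood of `A` in `ℍ̄`), the conformal image of the curve is followed THROUGH the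
instants at which the hull swallows whole `ρ`-clusters of `A`, `ρ = thrRadius A δ = min (δ/2)
(infDist 0 A / 2)`, up to the **through-swallow horizon** at cap level `N`,

  `thrHorizon κ A δ N ω = min (partialContactTime W A ρ) (capTimeK κ N ω) (N + 1)`,
  `W = drvK κ (brownianCPath ω)` (`= sleDriving κ ω`),

the minimum of the partial contact time of `LoewnerPartialContact` (first time the closed hull meets
the closed `ρ`-neighbourhood of a cluster not yet swallowed whole), of the cap time of the driver
(`SLEImageLocalisation`) and of the constant `N + 1`. Its properties (stopping time; closed remaining
hull with finitely many values and the trace `ρ`-far from `A` up to it; a.s. exhaustion of the first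
hit of the stopping set) are proved in `SLEThrHorizonProofs`.

## References

* G. F. Lawler, *Conformally Invariant Processes in the Plane* (2005), §6.3 Thm. 6.13. [Lawler2005]
* G. F. Lawler, O. Schramm, W. Werner, Acta Math. 187 (2001), Thm. 2.2. [LawlerSchrammWerner2001]
-/

noncomputable section

open Set Metric MeasureTheory
open scoped NNReal

namespace Literature.Probability.RandomPlanarGeometry

open Loewner

variable {A : Set ℂ} {δ : ℝ}

/-! ### The cluster radius -/

/-- The **cluster radius** `ρ = min (δ/2) (infDist 0 A / 2)` of the through-swallow horizon: half the
neighbourhood width, and less than the distance from `0` to `A`. [folklore] -/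
def thrRadius (A : Set ℂ) (δ : ℝ) : ℝ := min (δ / 2) (infDist 0 A / 2)

/-- Unfolding of the radius. [folklore] -/
theorem thrRadius_def (A : Set ℂ) (δ : ℝ) : thrRadius A δ = min (δ / 2) (infDist 0 A / 2) := rfl

/-- `ρ ≤ δ / 2`. [folklore] -/
theorem thrRadius_le_half (A : Set ℂ) (δ : ℝ) : thrRadius A δ ≤ δ / 2 := min_le_left _ _

/-- `ρ ≤ infDist 0 A / 2`. [folklore] -/
theorem thrRadius_le_half_infDist (A : Set ℂ) (δ : ℝ) : thrRadius A δ ≤ infDist 0 A / 2 :=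
  min_le_right _ _

/-- `0 < ρ` for a nonempty `*`-hull and `δ > 0`. [folklore] -/
theorem thrRadius_pos (hA : IsStarHull A) (hne : A.Nonempty) (hδ : 0 < δ) : 0 < thrRadius A δ :=
  lt_min (half_pos hδ) (half_pos (infDist_zero_pos hA hne).1)

/-- `ρ < infDist 0 A` for a nonempty `*`-hull. [folklore] -/
theorem thrRadius_lt_infDist (hA : IsStarHull A) (hne : A.Nonempty) (δ : ℝ) :
    thrRadius A δ < infDist 0 A :=
  (thrRadius_le_half_infDist A δ).trans_lt (half_lt_self (infDist_zero_pos hA hne).1)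

/-- `ρ < δ` for `δ > 0`. [folklore] -/
theorem thrRadius_lt (A : Set ℂ) (hδ : 0 < δ) : thrRadius A δ < δ :=
  (thrRadius_le_half A δ).trans_lt (half_lt_self hδ)

/-! ### The horizon -/

/-- **The through-swallow horizon at cap level `N`**: the minimum of the partial contact time of the
`ρ`-clusters of `A` under the chain of `drvK κ (brownianCPath ω)`, of the cap time of the driver,
and of `N + 1`. [cite: Lawler2005, §6.3 Thm. 6.13] -/
def thrHorizon (κ : ℝ≥0) (A : Set ℂ) (δ : ℝ) (N : ℕ) (ω : ℝ≥0 → ℝ) : WithTop ℝ≥0 :=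
  min (partialContactTime (drvK κ (brownianCPath ω)) A (thrRadius A δ))
    (min (capTimeK κ N ω) (((N : ℝ≥0) + 1 : ℝ≥0) : WithTop ℝ≥0))

variable {κ : ℝ≥0}

/-- Unfolding of the horizon. [folklore] -/
theorem thrHorizon_def (κ : ℝ≥0) (A : Set ℂ) (δ : ℝ) (N : ℕ) (ω : ℝ≥0 → ℝ) :
    thrHorizon κ A δ N ω = min (partialContactTime (drvK κ (brownianCPath ω)) A (thrRadius A δ))
      (min (capTimeK κ N ω) (((N : ℝ≥0) + 1 : ℝ≥0) : WithTop ℝ≥0)) := rfl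

/-- The horizon is at most the partial contact time. [folklore] -/
theorem thrHorizon_le_partialContactTime (N : ℕ) (ω : ℝ≥0 → ℝ) :
    thrHorizon κ A δ N ω ≤ partialContactTime (drvK κ (brownianCPath ω)) A (thrRadius A δ) :=
  min_le_left _ _

/-- The horizon is at most the cap time. [folklore] -/
theorem thrHorizon_le_capTimeK (N : ℕ) (ω : ℝ≥0 → ℝ) : thrHorizon κ A δ N ω ≤ capTimeK κ N ω :=
  (min_le_right _ _).trans (min_le_left _ _)

/-- **The horizon is at most `N + 1`.** [folklore] -/
theorem thrHorizon_le_succ (N : ℕ) (ω : ℝ≥0 → ℝ) :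
    thrHorizon κ A δ N ω ≤ (((N : ℝ≥0) + 1 : ℝ≥0) : WithTop ℝ≥0) :=
  (min_le_right _ _).trans (min_le_right _ _)

/-- The horizon is finite. [folklore] -/
theorem thrHorizon_ne_top (N : ℕ) (ω : ℝ≥0 → ℝ) : thrHorizon κ A δ N ω ≠ ⊤ :=
  ne_top_of_le_ne_top WithTop.coe_ne_top (thrHorizon_le_succ N ω)

/-- A time strictly before the horizon is strictly before the partial contact time. [folklore] -/
theorem coe_lt_partialContactTime_of_coe_lt_thrHorizon {N : ℕ} {ω : ℝ≥0 → ℝ} {t : ℝ≥0}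
    (ht : (t : WithTop ℝ≥0) < thrHorizon κ A δ N ω) :
    (t : WithTop ℝ≥0) < partialContactTime (drvK κ (brownianCPath ω)) A (thrRadius A δ) :=
  lt_of_lt_of_le ht (thrHorizon_le_partialContactTime N ω)

/-- A time up to the horizon is up to the partial contact time. [folklore] -/
theorem coe_le_partialContactTime_of_coe_le_thrHorizon {N : ℕ} {ω : ℝ≥0 → ℝ} {t : ℝ≥0}
    (ht : (t : WithTop ℝ≥0) ≤ thrHorizon κ A δ N ω) :
    (t : WithTop ℝ≥0) ≤ partialContactTime (drvK κ (brownianCPath ω)) A (thrRadius A δ) :=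
  ht.trans (thrHorizon_le_partialContactTime N ω)

end Literature.Probability.RandomPlanarGeometry

end
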